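import Summits.KontsevichZagierPeriods.KontsevichZagierPeriods.Theses.VeryGoodTransfer
import Literature.NumberTheory.Transcendental.KZSemiCanonicalReductionProofs
import Literature.NumberTheory.Transcendental.KZLogCalculusProofs
import Literature.NumberTheory.Transcendental.SemialgebraicMapsProofs

/-!
# Line `monomial-cube-atlas` for the crux `RationalRepsResolve`
(route VeryGoodTransfer, item stmt-KontsevichZagierPeriods-5089; crux-strategist, BC2 redirect — self-contained
registered skeleton: crux workfiles are not importable, so the proved glue `Split.lean` and the proofs of
the pieces X₂, X₃ are reproduced here verbatim.)

RationalRepsResolve = compactification inside the rules (the TREE's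
`KZ.exists_sub_sum_bounded_mem_relations`, Viu-Sos 2021 Thm. 2.1 at move level) ∘ resolution of the
bounded pieces, and the latter is cut into three KINDS of mathematics:

* X₁ `MonomialCubeAtlas` (real algebraic geometry) ⇐ `stub_monomialPatches` (a finite monomialising
  cube COVER of `(σ, p/q)` — the Hironaka-type content, the LOAD-BEARING stub) + `stub_partitionOfPatches`
  (any finite family of `ℚ`-semialgebraic cube charts admits `ℚ`-semialgebraic sub-pieces with the same
  total image and pairwise disjoint images — semialgebraic bookkeeping, provable now): `monomialCubeAtlas_of_stubs`;
* X₂ `CubeMonomialIntegrability` (analysis) — PROVED below (`cubeMonomialIntegrability`);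
* X₃ `ResolvedAtlasRealisation` (calculus of moves) — PROVED below (`resolvedAtlasRealisation`);
* glue `rationalRepsResolve_of_subs : X₁ → X₂ → X₃ → RationalRepsResolve` — PROVED below (= `Split.lean`);
* composition `RationalRepsResolve_of : stub_monomialPatches-sig → stub_partitionOfPatches-sig → (RationalRepsResolve
  unfolded)` and `RationalRepsResolve_closed : RationalRepsResolve` (the crux BY NAME, from the two stubs) — kernel-checked.

Sorries live ONLY in the two `stub_*` theorems.
-/

-- `Summit.KontsevichZagierPeriods.KontsevichZagierPeriods.…` is the tree's mandated single-conjunct layout (Sub = Summit),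
-- so the duplicated namespace component is intended.
set_option linter.dupNamespace false

noncomputable section

open MeasureTheory Set Filter
open scoped ENNReal Topology
open Literature.NumberTheory.Transcendental Literature.ModelTheory.ExponentialFields
open Literature.NumberTheory.Transcendental.KZ

namespace Summit.KontsevichZagierPeriods.KontsevichZagierPeriods.Cruxes.RationalRepsResolve.MonomialCubeAtlas

variable {n : ℕ}

/-! ### The open unit cube -/

/-- The open unit cube is open. [folklore] -/
theorem isOpen_cube : IsOpen {x : Fin n → ℝ | ∀ j, 0 < x j ∧ x j < 1} := by
  have : {x : Fin n → ℝ | ∀ j, 0 < x j ∧ x j < 1} = ⋂ j, ({x | 0 < x j} ∩ {x | x j < 1}) := by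
    ext x; simp [Set.mem_iInter]
  rw [this]
  exact isOpen_iInter_of_finite fun j =>
    (isOpen_lt continuous_const (continuous_apply j)).inter
      (isOpen_lt (continuous_apply j) continuous_const)

/-- The open unit cube is bounded. [folklore] -/
theorem isBounded_cube : Bornology.IsBounded {x : Fin n → ℝ | ∀ j, 0 < x j ∧ x j < 1} := by
  refine (isCompact_Icc (a := (0 : Fin n → ℝ)) (b := 1)).isBounded.subset fun x hx => ?_
  exact ⟨fun j => (hx j).1.le, fun j => (hx j).2.le⟩

/-! ### Re-indexing of iterated resolutions -/

/-- **Chaining resolutions.** If `c ≡ ∑ₜ [Rₜ]` modulo relations and every `[Rₜ]` is congruent to a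
`ℤ`-combination of representations satisfying `P`, then so is `c` (re-index the total family over
`Σ t, Fin (k t)` by `Fintype.equivFin`). [folklore] -/
theorem exists_fin_of_sub_sum {ι : Type*} [Fintype ι] (P : IntegralRep n → Prop) (c : FormalRep)
    (R : ι → IntegralRep n) (hrel : c - ∑ t, of (R t) ∈ relations)
    (hres : ∀ t, ∃ (k : ℕ) (ρ : Fin k → IntegralRep n) (ε : Fin k → ℤ),
      (∀ i, P (ρ i)) ∧ of (R t) - ∑ i, ε i • of (ρ i) ∈ relations) :
    ∃ (k : ℕ) (ρ : Fin k → IntegralRep n) (ε : Fin k → ℤ),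
      (∀ i, P (ρ i)) ∧ c - ∑ i, ε i • of (ρ i) ∈ relations := by
  classical
  choose k ρ ε hP hrelt using hres
  set S := Σ t : ι, Fin (k t)
  set e : S ≃ Fin (Fintype.card S) := Fintype.equivFin S
  refine ⟨Fintype.card S, fun j => ρ (e.symm j).1 (e.symm j).2, fun j => ε (e.symm j).1 (e.symm j).2,
    fun j => hP _ _, ?_⟩
  have hsum : ∑ j : Fin (Fintype.card S), ε (e.symm j).1 (e.symm j).2 • of (ρ (e.symm j).1 (e.symm j).2) =
      ∑ t, ∑ i, ε t i • of (ρ t i) := by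
    rw [Fintype.sum_equiv e.symm (fun j => ε (e.symm j).1 (e.symm j).2 • of (ρ (e.symm j).1 (e.symm j).2))
      (fun s : S => ε s.1 s.2 • of (ρ s.1 s.2)) (fun j => rfl)]
    rw [← Finset.univ_sigma_univ, Finset.sum_sigma]
  rw [hsum]
  have : c - ∑ t, ∑ i, ε t i • of (ρ t i) =
      (c - ∑ t, of (R t)) + ∑ t, (of (R t) - ∑ i, ε t i • of (ρ t i)) := by
    rw [Finset.sum_sub_distrib]; abel
  rw [this]
  exact relations.add_mem hrel (sum_mem fun t _ => hrelt t)


/-! ### The typed split -/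

/-- **Typed split of the crux `RationalRepsResolve`** (route VeryGoodTransfer, item
stmt-KontsevichZagierPeriods-5089; BC2 redirect): `MonomialCubeAtlas → CubeMonomialIntegrability →
ResolvedAtlasRealisation → RationalRepsResolve`, the three hypotheses being stated verbatim (they are
the route's split children). Proof: compactify inside the rules
(`KZ.exists_sub_sum_bounded_mem_relations`); a bounded piece of rational shape `p/q` with `p = 0` is
a relation (`KZ.of_mem_relations_of_eqOn_zero`); otherwise take the monomialising cube atlas (X₁),
transport absolute integrability of `p/q` on `φᵢ(C) ⊆ σ` to `uᵢ · ∏ xⱼ^{aᵢⱼ}` on the cube by the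
Jacobian formula, get `aᵢⱼ ≥ 0` from X₂, so that `gᵢ := uᵢ · ∏ xⱼ^{aᵢⱼ}` is `C¹` on the given
neighbourhood of the closed cube and `ℚ`-semialgebraic, realise the atlas `(τᵢ, φᵢ, gᵢ)` by X₃, and
re-index (`exists_fin_of_sub_sum`). [cite: ViuSos2021, Thm. 2.1 and Cor. 2.2] -/
theorem rationalRepsResolve_of_subs
    (hA : ∀ (n : ℕ) (σ : Set (Fin n → ℝ)) (p q : MvPolynomial (Fin n) ℚ),
        Literature.ModelTheory.ExponentialFields.IsSemialgebraic ℚ σ → Bornology.IsBounded σ → p ≠ 0 →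
        (∀ x ∈ σ, MvPolynomial.aeval x q ≠ 0) →
        ∃ (k : ℕ) (τ : Fin k → Set (Fin n → ℝ)) (φ : Fin k → (Fin n → ℝ) → (Fin n → ℝ))
          (φ' : Fin k → (Fin n → ℝ) → (Fin n → ℝ) →L[ℝ] (Fin n → ℝ)) (u : Fin k → (Fin n → ℝ) → ℝ)
          (U : Fin k → Set (Fin n → ℝ)) (a : Fin k → Fin n → ℤ),
          (∀ i, τ i ⊆ {x : Fin n → ℝ | ∀ j, 0 < x j ∧ x j < 1} ∧
            Literature.ModelTheory.ExponentialFields.IsSemialgebraic ℚ (τ i) ∧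
            Literature.NumberTheory.Transcendental.IsSemialgebraicMapOn ℚ {x : Fin n → ℝ | ∀ j, 0 < x j ∧ x j < 1} (φ i) ∧
            (∀ x ∈ {x : Fin n → ℝ | ∀ j, 0 < x j ∧ x j < 1},
              HasFDerivWithinAt (φ i) (φ' i x) {x : Fin n → ℝ | ∀ j, 0 < x j ∧ x j < 1} x) ∧
            Set.InjOn (φ i) {x : Fin n → ℝ | ∀ j, 0 < x j ∧ x j < 1} ∧
            φ i '' {x : Fin n → ℝ | ∀ j, 0 < x j ∧ x j < 1} ⊆ σ ∧
            Literature.ModelTheory.ExponentialFields.IsSemialgebraic ℚ (φ i '' τ i) ∧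
            IsOpen (U i) ∧ closure {x : Fin n → ℝ | ∀ j, 0 < x j ∧ x j < 1} ⊆ U i ∧
            ContDiffOn ℝ 1 (u i) (U i) ∧ (∀ x ∈ U i, u i x ≠ 0) ∧
            Literature.NumberTheory.Transcendental.IsSemialgebraicFunOn ℚ {x : Fin n → ℝ | ∀ j, 0 < x j ∧ x j < 1} (u i) ∧
            ∀ x ∈ {x : Fin n → ℝ | ∀ j, 0 < x j ∧ x j < 1},
              MvPolynomial.aeval (φ i x) p / MvPolynomial.aeval (φ i x) q * |(φ' i x).det| =
                u i x * ∏ j, x j ^ (a i j)) ∧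
          (∀ i j, i ≠ j → MeasureTheory.volume (φ i '' τ i ∩ φ j '' τ j) = 0) ∧
          MeasureTheory.volume (σ \ ⋃ i, φ i '' τ i) = 0)
    (hE : ∀ (n : ℕ) (a : Fin n → ℤ) (u : (Fin n → ℝ) → ℝ) (U : Set (Fin n → ℝ)),
        IsOpen U → closure {x : Fin n → ℝ | ∀ j, 0 < x j ∧ x j < 1} ⊆ U → ContinuousOn u U →
        (∀ x ∈ U, u x ≠ 0) →
        MeasureTheory.IntegrableOn (fun x => u x * ∏ j, x j ^ (a j)) {x : Fin n → ℝ | ∀ j, 0 < x j ∧ x j < 1} →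
        ∀ j, 0 ≤ a j)
    (hR : ∀ (n k : ℕ) (r : Literature.NumberTheory.Transcendental.KZ.IntegralRep n) (τ : Fin k → Set (Fin n → ℝ))
        (φ : Fin k → (Fin n → ℝ) → (Fin n → ℝ)) (φ' : Fin k → (Fin n → ℝ) → (Fin n → ℝ) →L[ℝ] (Fin n → ℝ))
        (g : Fin k → (Fin n → ℝ) → ℝ) (U : Fin k → Set (Fin n → ℝ)),
        (∀ i, Literature.ModelTheory.ExponentialFields.IsSemialgebraic ℚ (τ i) ∧ Bornology.IsBounded (τ i) ∧
          Literature.NumberTheory.Transcendental.IsSemialgebraicMapOn ℚ (τ i) (φ i) ∧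
          (∀ x ∈ τ i, HasFDerivWithinAt (φ i) (φ' i x) (τ i) x) ∧ Set.InjOn (φ i) (τ i) ∧
          Literature.ModelTheory.ExponentialFields.IsSemialgebraic ℚ (φ i '' τ i) ∧ φ i '' τ i ⊆ r.domain ∧
          IsOpen (U i) ∧ closure (τ i) ⊆ U i ∧ ContDiffOn ℝ 1 (g i) (U i) ∧
          Literature.NumberTheory.Transcendental.IsSemialgebraicFunOn ℚ (τ i) (g i) ∧
          ∀ x ∈ τ i, g i x = r.integrand (φ i x) * |(φ' i x).det|) →
        (∀ i j, i ≠ j → MeasureTheory.volume (φ i '' τ i ∩ φ j '' τ j) = 0) →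
        MeasureTheory.volume (r.domain \ ⋃ i, φ i '' τ i) = 0 →
        ∃ (k' : ℕ) (ρ : Fin k' → Literature.NumberTheory.Transcendental.KZ.IntegralRep n) (ε : Fin k' → ℤ),
          (∀ i, Bornology.IsBounded (ρ i).domain ∧ ∃ V : Set (Fin n → ℝ), IsOpen V ∧ closure (ρ i).domain ⊆ V ∧
            ContDiffOn ℝ 1 (ρ i).integrand V) ∧
          Literature.NumberTheory.Transcendental.KZ.of r - ∑ i, ε i • Literature.NumberTheory.Transcendental.KZ.of (ρ i) ∈
            Literature.NumberTheory.Transcendental.KZ.relations) :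
    -- the crux `VeryGoodTransfer.RationalRepsResolve`, UNFOLDED (so that only `RationalRepsResolve_of`
    -- below concludes the crux by name, as the skeleton lint requires)
    (∀ (n : ℕ) (r : Literature.NumberTheory.Transcendental.KZ.IntegralRep n), r.IsRational → ∃ (k : ℕ) (ρ : Fin k → Literature.NumberTheory.Transcendental.KZ.IntegralRep n) (ε : Fin k → ℤ), (∀ i, Bornology.IsBounded (ρ i).domain ∧ ∃ U : Set (Fin n → ℝ), IsOpen U ∧ closure (ρ i).domain ⊆ U ∧ ContDiffOn ℝ 1 (ρ i).integrand U) ∧ Literature.NumberTheory.Transcendental.KZ.of r - ∑ i, ε i • Literature.NumberTheory.Transcendental.KZ.of (ρ i) ∈ Literature.NumberTheory.Transcendental.KZ.relations) := by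
  intro n r₀ hr₀
  obtain ⟨R, hRb, hrel⟩ := exists_sub_sum_bounded_mem_relations r₀ hr₀
  refine exists_fin_of_sub_sum
    (fun ρ : IntegralRep n => Bornology.IsBounded ρ.domain ∧ ∃ V : Set (Fin n → ℝ), IsOpen V ∧
      closure ρ.domain ⊆ V ∧ ContDiffOn ℝ 1 ρ.integrand V)
    (of r₀) R hrel fun T => ?_
  -- one bounded piece `r := R T` of rational shape `p / q`
  obtain ⟨hr, hb⟩ := hRb T
  generalize R T = r at hr hb ⊢
  classical
  obtain ⟨p, q, hq, hpq⟩ := hr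
  by_cases hp : p = 0
  · refine ⟨0, Fin.elim0, Fin.elim0, fun i => i.elim0, ?_⟩
    rw [Finset.univ_eq_empty, Finset.sum_empty, sub_zero]
    exact of_mem_relations_of_eqOn_zero r fun x hx => by simp [hpq hx, hp]
  obtain ⟨k, τ, φ, φ', u, U, a, hch, hdisj, hcov⟩ :=
    hA n r.domain p q r.isSemialgebraic_domain hb hp hq
  set C : Set (Fin n → ℝ) := {x | ∀ j, 0 < x j ∧ x j < 1} with hC
  have hCo : IsOpen C := isOpen_cube
  have hCm : MeasurableSet C := hCo.measurableSet
  have hCb : Bornology.IsBounded C := isBounded_cube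
  -- (1) the exponents are non-negative
  have ha : ∀ i j, 0 ≤ a i j := by
    intro i
    obtain ⟨-, -, -, hφ', hinj, himg, -, hUo, hCU, hu, hu0, -, hmono⟩ := hch i
    have h1 : IntegrableOn r.integrand (φ i '' C) := r.integrableOn.mono_set himg
    have h2 := (integrableOn_image_iff_integrableOn_abs_det_fderiv_smul volume hCm hφ' hinj
      r.integrand).1 h1
    have h3 : IntegrableOn (fun x => u i x * ∏ j, x j ^ (a i j)) C := by
      refine h2.congr_fun (fun x hx => ?_) hCm
      have hxσ : φ i x ∈ r.domain := himg ⟨x, hx, rfl⟩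
      show |(φ' i x).det| • r.integrand (φ i x) = _
      rw [smul_eq_mul, hpq hxσ, mul_comm]
      exact hmono x hx
    exact hE n (a i) (u i) (U i) hUo hCU hu.continuousOn hu0 h3
  -- (2) the `C¹` integrands
  set g : Fin k → (Fin n → ℝ) → ℝ := fun i x => u i x * ∏ j, x j ^ (a i j).toNat with hg
  have hg_eq : ∀ i x, g i x = u i x * ∏ j, x j ^ (a i j) := by
    intro i x
    simp only [hg]
    congr 1
    exact Finset.prod_congr rfl fun j _ => by
      rw [← zpow_natCast, Int.toNat_of_nonneg (ha i j)]
  have hgC1 : ∀ i, ContDiffOn ℝ 1 (g i) (U i) := by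
    intro i
    obtain ⟨-, -, -, -, -, -, -, -, -, hu, -, -, -⟩ := hch i
    have hpoly : ContDiff ℝ 1 (fun x : Fin n → ℝ => ∏ j, x j ^ (a i j).toNat) :=
      contDiff_prod fun j _ => (contDiff_apply ℝ ℝ j).pow _
    exact hu.mul hpoly.contDiffOn
  have hgsa : ∀ i, IsSemialgebraicFunOn ℚ (τ i) (g i) := by
    intro i
    obtain ⟨hτC, hτs, -, -, -, -, -, -, -, -, -, husa, -⟩ := hch i
    have h1 : IsSemialgebraicFunOn ℚ (τ i) (u i) := husa.mono hτC hτs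
    have h2 : IsSemialgebraicFunOn ℚ (τ i) (fun x : Fin n → ℝ => ∏ j, x j ^ (a i j).toNat) :=
      (isSemialgebraicFunOn_aeval hτs
        (∏ j, (MvPolynomial.X j : MvPolynomial (Fin n) ℚ) ^ (a i j).toNat)).congr
        fun x _ => by simp [map_prod]
    exact (IsSemialgebraicFunOn.mul_holds h1 h2).congr fun x _ => by simp [hg]
  -- (3) realise the atlas by the moves
  refine hR n k r τ φ φ' g U (fun i => ?_) hdisj hcov
  obtain ⟨hτC, hτs, hφs, hφ', hinj, himg, himgs, hUo, hCU, hu, hu0, husa, hmono⟩ := hch i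
  refine ⟨hτs, hCb.subset hτC, hφs.mono hτC hτs, fun x hx => (hφ' x (hτC hx)).mono hτC,
    hinj.mono hτC, himgs, (image_mono hτC).trans himg, hUo, (closure_mono hτC).trans hCU,
    hgC1 i, hgsa i, fun x hx => ?_⟩
  have hxσ : φ i x ∈ r.domain := himg ⟨x, hτC hx, rfl⟩
  rw [hg_eq, ← hmono x (hτC hx), hpq hxσ]

/-! ## X₃ — resolved atlas realisation (PROVED) -/

/-- **X₃ `ResolvedAtlasRealisation`** (stated verbatim): a resolved atlas is realised by rules (1a) + (2).
[cite: KontsevichZagier2001, §1.2 rules (1), (2)] -/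
theorem resolvedAtlasRealisation :
    ∀ (n k : ℕ) (r : Literature.NumberTheory.Transcendental.KZ.IntegralRep n) (τ : Fin k → Set (Fin n → ℝ)) (φ : Fin k → (Fin n → ℝ) → (Fin n → ℝ)) (φ' : Fin k → (Fin n → ℝ) → (Fin n → ℝ) →L[ℝ] (Fin n → ℝ)) (g : Fin k → (Fin n → ℝ) → ℝ) (U : Fin k → Set (Fin n → ℝ)), (∀ i, Literature.ModelTheory.ExponentialFields.IsSemialgebraic ℚ (τ i) ∧ Bornology.IsBounded (τ i) ∧ Literature.NumberTheory.Transcendental.IsSemialgebraicMapOn ℚ (τ i) (φ i) ∧ (∀ x ∈ τ i, HasFDerivWithinAt (φ i) (φ' i x) (τ i) x) ∧ Set.InjOn (φ i) (τ i) ∧ Literature.ModelTheory.ExponentialFields.IsSemialgebraic ℚ (φ i '' τ i) ∧ φ i '' τ i ⊆ r.domain ∧ IsOpen (U i) ∧ closure (τ i) ⊆ U i ∧ ContDiffOn ℝ 1 (g i) (U i) ∧ Literature.NumberTheory.Transcendental.IsSemialgebraicFunOn ℚ (τ i) (g i) ∧ ∀ x ∈ τ i, g i x = r.integrand (φ i x)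 * |(φ' i x).det|) → (∀ i j, i ≠ j → MeasureTheory.volume (φ i '' τ i ∩ φ j '' τ j) = 0) → MeasureTheory.volume (r.domain \ ⋃ i, φ i '' τ i) = 0 → ∃ (k' : ℕ) (ρ : Fin k' → Literature.NumberTheory.Transcendental.KZ.IntegralRep n) (ε : Fin k' → ℤ), (∀ i, Bornology.IsBounded (ρ i).domain ∧ ∃ V : Set (Fin n → ℝ), IsOpen V ∧ closure (ρ i).domain ⊆ V ∧ ContDiffOn ℝ 1 (ρ i).integrand V) ∧ Literature.NumberTheory.Transcendental.KZ.of r - ∑ i, ε i • Literature.NumberTheory.Transcendental.KZ.of (ρ i) ∈ Literature.NumberTheory.Transcendental.KZ.relations := by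
  intro n k r τ φ φ' g U hch hdisj hcov
  classical
  have h1 : ∀ i, IsSemialgebraic ℚ (τ i) := fun i => (hch i).1
  have h2 : ∀ i, Bornology.IsBounded (τ i) := fun i => (hch i).2.1
  have h3 : ∀ i, IsSemialgebraicMapOn ℚ (τ i) (φ i) := fun i => (hch i).2.2.1
  have h4 : ∀ i, ∀ x ∈ τ i, HasFDerivWithinAt (φ i) (φ' i x) (τ i) x := fun i => (hch i).2.2.2.1
  have h5 : ∀ i, InjOn (φ i) (τ i) := fun i => (hch i).2.2.2.2.1
  have h6 : ∀ i, IsSemialgebraic ℚ (φ i '' τ i) := fun i => (hch i).2.2.2.2.2.1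
  have h7 : ∀ i, φ i '' τ i ⊆ r.domain := fun i => (hch i).2.2.2.2.2.2.1
  have h8 : ∀ i, IsOpen (U i) := fun i => (hch i).2.2.2.2.2.2.2.1
  have h9 : ∀ i, closure (τ i) ⊆ U i := fun i => (hch i).2.2.2.2.2.2.2.2.1
  have h10 : ∀ i, ContDiffOn ℝ 1 (g i) (U i) := fun i => (hch i).2.2.2.2.2.2.2.2.2.1
  have h11 : ∀ i, IsSemialgebraicFunOn ℚ (τ i) (g i) := fun i => (hch i).2.2.2.2.2.2.2.2.2.2.1
  have h12 : ∀ i, ∀ x ∈ τ i, g i x = r.integrand (φ i x) * |(φ' i x).det| :=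
    fun i => (hch i).2.2.2.2.2.2.2.2.2.2.2
  -- the new integrands are integrable: continuous on the compact closure
  have hint : ∀ i, IntegrableOn (g i) (τ i) := fun i =>
    (((h10 i).continuousOn.mono (h9 i)).integrableOn_compact (h2 i).isCompact_closure).mono_set
      subset_closure
  -- the resolved representations `[τᵢ, gᵢ]` and the traces `[φᵢ(τᵢ), r.integrand]`
  set ρ : Fin k → IntegralRep n := fun i => ⟨τ i, g i, h1 i, h11 i, hint i⟩ with hρ
  set S : Fin k → IntegralRep n := fun i => r.restrict (φ i '' τ i) (h6 i) (h7 i) with hS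
  -- rule (1a): `[r] ≡ ∑ᵢ [Sᵢ]`
  have e1 : of r - ∑ i, of (S i) ∈ relations := by
    refine of_sub_sum_of_mem_relations Finset.univ r S (fun i _ => ?_) (fun i _ _ _ => rfl) ?_ ?_
    · rw [show (S i).domain \ r.domain = ∅ from sdiff_eq_empty.mpr (h7 i), measure_empty]
    · have : r.domain \ ⋃ i ∈ (Finset.univ : Finset (Fin k)), (S i).domain = r.domain \ ⋃ i, φ i '' τ i := by
        congr 1
        ext x
        simp [hS]
      rw [this]
      exact hcov
    · intro i _ j _ hij
      exact hdisj i j hij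
  -- rule (2): `[ρᵢ] − [Sᵢ]` is a change-of-variables move
  have e2 : ∀ i, of (ρ i) - of (S i) ∈ changeOfVariablesRel := fun i =>
    ⟨n, ρ i, S i, φ i, φ' i, h3 i, h4 i, h5 i, rfl, fun x hx => h12 i x hx, rfl⟩
  have e3 : ∑ i, of (ρ i) - ∑ i, of (S i) ∈ relations :=
    sum_sub_sum_mem_relations Finset.univ _ _ fun i _ => changeOfVariablesRel_subset_relations (e2 i)
  refine ⟨k, ρ, fun _ => 1, fun i => ⟨h2 i, U i, h8 i, h9 i, h10 i⟩, ?_⟩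
  have : of r - ∑ i, (1 : ℤ) • of (ρ i) = (of r - ∑ i, of (S i)) - (∑ i, of (ρ i) - ∑ i, of (S i)) := by
    simp only [one_smul]
    abel
  rw [this]
  exact relations.sub_mem e1 e3


/-! ## X₂ — integrable monomials on the cube have non-negative exponents (PROVED) -/

/-- `t ↦ t ^ a` (`a : ℤ`) is integrable on `(0,1)` iff `0 ≤ a`. [folklore] -/
theorem integrableOn_zpow_Ioo_iff (a : ℤ) :
    IntegrableOn (fun t : ℝ => t ^ a) (Ioo (0:ℝ) 1) ↔ 0 ≤ a := by
  have h := intervalIntegral.integrableOn_Ioo_rpow_iff (s := (a : ℝ)) zero_lt_one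
  have hcongr : IntegrableOn (fun t : ℝ => t ^ a) (Ioo (0:ℝ) 1) ↔
      IntegrableOn (fun t : ℝ => t ^ (a : ℝ)) (Ioo (0:ℝ) 1) := by
    refine integrableOn_congr_fun (fun t _ => ?_) measurableSet_Ioo
    rw [Real.rpow_intCast]
  rw [hcongr, h]
  constructor
  · intro h'
    have : (-1 : ℤ) < a := by exact_mod_cast h'
    omega
  · intro h'
    have : (-1 : ℤ) < a := by omega
    exact_mod_cast this

/-- The open unit cube as a `Set.pi`. [folklore] -/
theorem cube_eq_pi (n : ℕ) :
    {x : Fin n → ℝ | ∀ j, 0 < x j ∧ x j < 1} = Set.pi Set.univ fun _ => Ioo (0:ℝ) 1 := by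
  ext x; simp [Set.mem_pi]

/-- The open unit cube has volume `1`. [folklore] -/
theorem volume_cube (n : ℕ) : volume {x : Fin n → ℝ | ∀ j, 0 < x j ∧ x j < 1} = 1 := by
  rw [cube_eq_pi, Real.volume_pi_Ioo]
  simp

/-- A monomial with integer exponents is continuous on the open unit cube. [folklore] -/
theorem continuousOn_monomial (n : ℕ) (a : Fin n → ℤ) :
    ContinuousOn (fun x : Fin n → ℝ => ∏ j, x j ^ (a j)) {x : Fin n → ℝ | ∀ j, 0 < x j ∧ x j < 1} := by
  refine continuousOn_finsetProd _ fun j _ => ?_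
  exact (continuous_apply j).continuousOn.zpow₀ _ fun x hx => Or.inl (hx j).1.ne'

/-- **X₂ `CubeMonomialIntegrability`** (stated verbatim).
[cite: HuberMullerStachPeriodsIII2015, Lemma 11.2.2] -/
theorem cubeMonomialIntegrability :
    ∀ (n : ℕ) (a : Fin n → ℤ) (u : (Fin n → ℝ) → ℝ) (U : Set (Fin n → ℝ)), IsOpen U → closure {x : Fin n → ℝ | ∀ j, 0 < x j ∧ x j < 1} ⊆ U → ContinuousOn u U → (∀ x ∈ U, u x ≠ 0) → MeasureTheory.IntegrableOn (fun x => u x * ∏ j, x j ^ (a j)) {x : Fin n → ℝ | ∀ j, 0 < x j ∧ x j < 1} → ∀ j, 0 ≤ a j := by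
  intro n a u U hU hcl hu hu0 hint j
  classical
  by_contra hneg
  replace hneg : a j < 0 := not_le.mp hneg
  set C : Set (Fin n → ℝ) := {x | ∀ j, 0 < x j ∧ x j < 1} with hC
  have hCo : IsOpen C := by
    rw [hC, cube_eq_pi]; exact isOpen_set_pi finite_univ fun _ _ => isOpen_Ioo
  have hCm : MeasurableSet C := hCo.measurableSet
  have hCb : Bornology.IsBounded C := by
    refine (isCompact_Icc (a := (0 : Fin n → ℝ)) (b := 1)).isBounded.subset fun x hx => ?_
    exact ⟨fun j => (hx j).1.le, fun j => (hx j).2.le⟩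
  have hCne : C.Nonempty := ⟨fun _ => 1/2, fun j => by norm_num⟩
  -- Step 1: strip the unit
  have hKc : IsCompact (closure C) := hCb.isCompact_closure
  obtain ⟨x₀, hx₀, hmin⟩ := hKc.exists_isMinOn hCne.closure
    ((continuous_abs.comp_continuousOn (hu.mono hcl)))
  set c : ℝ := |u x₀| with hc_def
  have hc : 0 < c := abs_pos.mpr (hu0 x₀ (hcl hx₀))
  have hcle : ∀ x ∈ C, c ≤ |u x| := fun x hx => hmin (subset_closure hx)
  set m : (Fin n → ℝ) → ℝ := fun x => ∏ j, x j ^ (a j) with hm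
  have hm_int : IntegrableOn m C := by
    have h1 : IntegrableOn (fun x => (u x)⁻¹ * (u x * m x)) C := by
      refine Integrable.bdd_mul (c := c⁻¹) hint ?_ ?_
      · exact ((hu.mono (subset_closure.trans hcl)).inv₀
          fun x hx => hu0 x (hcl (subset_closure hx))).aestronglyMeasurable hCm
      · filter_upwards [ae_restrict_mem hCm] with x hx
        rw [norm_inv, Real.norm_eq_abs]
        exact inv_anti₀ hc (hcle x hx)
    refine h1.congr_fun (fun x hx => ?_) hCm
    have : u x ≠ 0 := hu0 x (hcl (subset_closure hx))
    field_simp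
  -- Step 2: `n = n' + 1`
  obtain ⟨n', rfl⟩ : ∃ n', n = n' + 1 := ⟨n - 1, (Nat.succ_pred_eq_of_pos (Fin.pos j)).symm⟩
  -- Step 3: split off the coordinate `j`
  set C' : Set (Fin n' → ℝ) := {y | ∀ i, 0 < y i ∧ y i < 1} with hC'
  have hC'm : MeasurableSet C' := by
    rw [hC', cube_eq_pi]; exact MeasurableSet.univ_pi fun _ => measurableSet_Ioo
  set e := MeasurableEquiv.piFinSuccAbove (fun _ : Fin (n' + 1) => ℝ) j with he_def
  have he : MeasurePreserving e volume volume := volume_preserving_piFinSuccAbove (fun _ => ℝ) j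
  have he_apply : ∀ x : Fin (n' + 1) → ℝ, e x = (x j, fun i => x (j.succAbove i)) := fun x => rfl
  have hpre : e ⁻¹' (Ioo (0:ℝ) 1 ×ˢ C') = C := by
    ext x
    simp only [mem_preimage, he_apply, mem_prod, mem_Ioo, hC', hC, mem_setOf_eq]
    rw [Fin.forall_iff_succAbove j]
  set g : (Fin n' → ℝ) → ℝ := fun y => ∏ i, y i ^ (a (j.succAbove i)) with hg
  set F : ℝ × (Fin n' → ℝ) → ℝ := fun p => p.1 ^ (a j) * g p.2 with hF
  have hFm : ∀ x, F (e x) = m x := fun x => by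
    simp only [hF, hg, hm, he_apply]
    rw [Fin.prod_univ_succAbove _ j]
  have hF_int : IntegrableOn F (Ioo (0:ℝ) 1 ×ˢ C') (volume.prod volume) := by
    have h := (he.integrableOn_comp_preimage e.measurableEmbedding (f := F) (s := Ioo (0:ℝ) 1 ×ˢ C'))
    rw [hpre] at h
    rw [← Measure.volume_eq_prod]
    exact h.1 (hm_int.congr_fun (fun x _ => (hFm x).symm) hCm)
  -- Step 4: Tonelli on the product of restricted measures
  rw [IntegrableOn, ← Measure.prod_restrict] at hF_int
  have hf1 : AEMeasurable (fun t : ℝ => ‖t ^ (a j)‖ₑ) (volume.restrict (Ioo (0:ℝ) 1)) :=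
    ((continuousOn_id.zpow₀ _ fun t ht => Or.inl ht.1.ne').aemeasurable measurableSet_Ioo).enorm
  have hg2 : AEMeasurable (fun y => ‖g y‖ₑ) (volume.restrict C') :=
    ((continuousOn_monomial n' _).aemeasurable hC'm).enorm
  have hlin : ∫⁻ p, ‖F p‖ₑ ∂((volume.restrict (Ioo (0:ℝ) 1)).prod (volume.restrict C')) =
      (∫⁻ t, ‖t ^ (a j)‖ₑ ∂(volume.restrict (Ioo (0:ℝ) 1))) * ∫⁻ y, ‖g y‖ₑ ∂(volume.restrict C') := by
    rw [← lintegral_prod_mul hf1 hg2]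
    refine lintegral_congr fun p => ?_
    simp only [hF, enorm_mul]
  have hfin : (∫⁻ t, ‖t ^ (a j)‖ₑ ∂(volume.restrict (Ioo (0:ℝ) 1))) * ∫⁻ y, ‖g y‖ₑ ∂(volume.restrict C') < ∞ := by
    rw [← hlin]; exact hF_int.hasFiniteIntegral
  -- Step 5: both factors are non-zero
  have hL1 : (∫⁻ t, ‖t ^ (a j)‖ₑ ∂(volume.restrict (Ioo (0:ℝ) 1))) ≠ 0 := by
    intro h0
    have hae := (lintegral_eq_zero_iff' hf1).mp h0
    -- `t ^ a = 0` a.e. on `(0,1)`: impossible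
    have : ∀ᵐ t ∂(volume.restrict (Ioo (0:ℝ) 1)), False := by
      filter_upwards [hae, ae_restrict_mem measurableSet_Ioo] with t ht hmem
      have h1 : t ^ (a j) ≠ 0 := zpow_ne_zero _ hmem.1.ne'
      simp only [Pi.zero_apply, enorm_eq_zero] at ht
      exact h1 ht
    rw [eventually_false_iff_eq_bot, ae_eq_bot, Measure.restrict_eq_zero] at this
    simp at this
  have hL2 : (∫⁻ y, ‖g y‖ₑ ∂(volume.restrict C')) ≠ 0 := by
    intro h0
    have hae := (lintegral_eq_zero_iff' hg2).mp h0
    have : ∀ᵐ y ∂(volume.restrict C'), False := by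
      filter_upwards [hae, ae_restrict_mem hC'm] with y hy hmem
      have h1 : g y ≠ 0 := by
        simp only [hg]
        exact Finset.prod_ne_zero_iff.mpr fun i _ => zpow_ne_zero _ (hmem i).1.ne'
      simp only [Pi.zero_apply, enorm_eq_zero] at hy
      exact h1 hy
    rw [eventually_false_iff_eq_bot, ae_eq_bot, Measure.restrict_eq_zero] at this
    have hvol : volume C' = 1 := volume_cube n'
    rw [this] at hvol
    exact zero_ne_one hvol
  -- Step 6: hence `t ↦ t ^ a j` is integrable on `(0,1)`, so `0 ≤ a j`
  have hL1fin : (∫⁻ t, ‖t ^ (a j)‖ₑ ∂(volume.restrict (Ioo (0:ℝ) 1))) < ∞ := by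
    rcases ENNReal.mul_lt_top_iff.mp hfin with h | h | h
    · exact h.1
    · exact absurd h hL1
    · exact absurd h hL2
  have hInt : IntegrableOn (fun t : ℝ => t ^ (a j)) (Ioo (0:ℝ) 1) :=
    ⟨((continuousOn_id.zpow₀ _ fun t ht => Or.inl ht.1.ne').aestronglyMeasurable measurableSet_Ioo),
      hL1fin⟩
  have := (integrableOn_zpow_Ioo_iff (a j)).mp hInt
  omega


/-! ## The two registered stubs of the line and X₁ from them -/

/-- **Stub 1 — finite monomialising cube cover** (the load-bearing, Hironaka-type stub; pure real
algebraic geometry, no integral / value / move): for a bounded `ℚ`-semialgebraic `σ ⊆ ℝⁿ`, `p ≠ 0`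
and `q` non-vanishing on `σ`, finitely many injective `ℚ`-semialgebraic differentiable charts `φᵢ`
of the open unit cube `C` with `φᵢ(C) ⊆ σ`, covering `σ` up to a null set (overlaps allowed), such
that on all of `C` the pulled-back density `(p/q ∘ φᵢ)·|det φᵢ'| = uᵢ · ∏ⱼ xⱼ ^ aᵢⱼ` with integer
exponents and a unit `uᵢ` (`C¹`, non-vanishing on an open `Uᵢ ⊇ closure C`, `ℚ`-semialgebraic on
`C`). Intended proof: log resolution `π` of `D = V(h·p·q) ⊇ Zar(∂σ)` over `ℚ`, iso off `D`
(Hironaka 1964; Włodarczyk 2005; Kollár 2007): `∂(π⁻¹(int σ ∖ D)) ⊆ E = π⁻¹D` (SNC), so in every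
`E`-adapted rational coordinate box the preimage is a union of FULL orthant sectors; `p∘π`, `q∘π`,
`Jac π` are unit × monomial in the local equations of `E`; finitely many boxes on the compact
`π⁻¹(closure σ)(ℝ)`; every active sector rescaled to `C`; charts `π ∘ coords⁻¹ ∘ affine` are Nash
and `ℝ_alg`-definable, i.e. `ℚ`-semialgebraic. `n ≤ 2`: point blow-ups of plane curves.
[cite: ViuSos2021, Thm. 2.2, Prop. 2.2 and Cor. 2.2] -/
theorem stub_monomialPatches :
    ∀ (n : ℕ) (σ : Set (Fin n → ℝ)) (p q : MvPolynomial (Fin n) ℚ), Literature.ModelTheory.ExponentialFields.IsSemialgebraic ℚ σ → Bornology.IsBounded σ → p ≠ 0 → (∀ x ∈ σ, MvPolynomial.aeval x q ≠ 0) → ∃ (k : ℕ) (φ : Fin k → (Fin n → ℝ) → (Fin n → ℝ)) (φ' : Fin k → (Fin n → ℝ) → (Fin n → ℝ) →L[ℝ] (Fin n → ℝ)) (u : Fin k → (Fin n → ℝ) → ℝ) (U : Fin k → Set (Fin n → ℝ)) (a : Fin k → Fin n → ℤ), (∀ i, Literature.NumberTheory.Transcendental.IsSemialgebraicMapOn ℚ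 {x : Fin n → ℝ | ∀ j, 0 < x j ∧ x j < 1} (φ i) ∧ (∀ x ∈ {x : Fin n → ℝ | ∀ j, 0 < x j ∧ x j < 1}, HasFDerivWithinAt (φ i) (φ' i x) {x : Fin n → ℝ | ∀ j, 0 < x j ∧ x j < 1} x) ∧ Set.InjOn (φ i) {x : Fin n → ℝ | ∀ j, 0 < x j ∧ x j < 1} ∧ φ i '' {x : Fin n → ℝ | ∀ j, 0 < x j ∧ x j < 1} ⊆ σ ∧ IsOpen (U i) ∧ closure {x : Fin n → ℝ | ∀ j, 0 < x j ∧ x j < 1} ⊆ U i ∧ ContDiffOn ℝ 1 (u i) (U i) ∧ (∀ x ∈ U i, u i x ≠ 0) ∧ Literature.NumberTheory.Transcendental.IsSemialgebraicFunOn ℚ {x : Fin n → ℝ | ∀ j, 0 < x j ∧ x j < 1} (u i) ∧ ∀ x ∈ {x : Fin n → ℝ | ∀ j, 0 < x j ∧ x j < 1}, MvPolynomial.aeval (φ i x) p / MvPolynomial.aeval (φ i x) q * |(φ' i x).det| = u i x * ∏ j, x j ^ (a i j)) ∧ MeasureTheory.volume (σ \ ⋃ i, φ i '' {x : Fin n →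 ℝ | ∀ j, 0 < x j ∧ x j < 1}) = 0 := by
  sorry

/-- **Stub 2 — partition of patches** (semialgebraic bookkeeping, provable now, size M): a finite
family of `ℚ`-semialgebraic charts of the open unit cube admits `ℚ`-semialgebraic sub-pieces
`τᵢ ⊆ C` with `ℚ`-semialgebraic, pairwise disjoint images and the same total image
(`τᵢ := {x ∈ C | φᵢ x ∉ ⋃_{l<i} φₗ(C)}`; images and preimages of semialgebraic sets under
semialgebraic maps are semialgebraic by Tarski–Seidenberg, tree `isSemialgebraic_image_holds`).
[cite: BochnakCosteRoy1998, Prop. 2.2.7] -/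
theorem stub_partitionOfPatches :
    ∀ (n k : ℕ) (φ : Fin k → (Fin n → ℝ) → (Fin n → ℝ)), (∀ i, Literature.NumberTheory.Transcendental.IsSemialgebraicMapOn ℚ {x : Fin n → ℝ | ∀ j, 0 < x j ∧ x j < 1} (φ i)) → ∃ τ : Fin k → Set (Fin n → ℝ), (∀ i, τ i ⊆ {x : Fin n → ℝ | ∀ j, 0 < x j ∧ x j < 1} ∧ Literature.ModelTheory.ExponentialFields.IsSemialgebraic ℚ (τ i) ∧ Literature.ModelTheory.ExponentialFields.IsSemialgebraic ℚ (φ i '' τ i)) ∧ (∀ i j, i ≠ j → MeasureTheory.volume (φ i '' τ i ∩ φ j '' τ j) = 0) ∧ (⋃ i, φ i '' τ i) = ⋃ i, φ i '' {x : Fin n → ℝ | ∀ j, 0 < x j ∧ x j < 1} := by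
  sorry

/-- **X₁ from the two stubs**: the monomialising cube ATLAS (pairwise null-overlapping images) is the
cover of stub 1 refined by the sub-pieces of stub 2. [folklore] -/
theorem monomialCubeAtlas_of_stubs
    (h₁ : ∀ (n : ℕ) (σ : Set (Fin n → ℝ)) (p q : MvPolynomial (Fin n) ℚ), Literature.ModelTheory.ExponentialFields.IsSemialgebraic ℚ σ → Bornology.IsBounded σ → p ≠ 0 → (∀ x ∈ σ, MvPolynomial.aeval x q ≠ 0) → ∃ (k : ℕ) (φ : Fin k → (Fin n → ℝ) → (Fin n → ℝ)) (φ' : Fin k → (Fin n → ℝ) → (Fin n → ℝ) →L[ℝ] (Fin n → ℝ)) (u : Fin k → (Fin n → ℝ) → ℝ) (U : Fin k → Set (Fin n → ℝ)) (a : Fin k → Fin n → ℤ), (∀ i, Literature.NumberTheory.Transcendental.IsSemialgebraicMapOn ℚ {x : Fin n → ℝ | ∀ j, 0 < x j ∧ x j < 1} (φ i) ∧ (∀ x ∈ {x : Fin n → ℝ | ∀ j, 0 < x j ∧ x j < 1}, HasFDerivWithinAt (φ i) (φ' i x) {x : Fin n → ℝ | ∀ j, 0 < x j ∧ x j < 1}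 x) ∧ Set.InjOn (φ i) {x : Fin n → ℝ | ∀ j, 0 < x j ∧ x j < 1} ∧ φ i '' {x : Fin n → ℝ | ∀ j, 0 < x j ∧ x j < 1} ⊆ σ ∧ IsOpen (U i) ∧ closure {x : Fin n → ℝ | ∀ j, 0 < x j ∧ x j < 1} ⊆ U i ∧ ContDiffOn ℝ 1 (u i) (U i) ∧ (∀ x ∈ U i, u i x ≠ 0) ∧ Literature.NumberTheory.Transcendental.IsSemialgebraicFunOn ℚ {x : Fin n → ℝ | ∀ j, 0 < x j ∧ x j < 1} (u i) ∧ ∀ x ∈ {x : Fin n → ℝ | ∀ j, 0 < x j ∧ x j < 1}, MvPolynomial.aeval (φ i x) p / MvPolynomial.aeval (φ i x) q * |(φ' i x).det| = u i x * ∏ j, x j ^ (a i j)) ∧ MeasureTheory.volume (σ \ ⋃ i, φ i '' {x : Fin n → ℝ | ∀ j, 0 < x j ∧ x j < 1}) = 0)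
    (h₂ : ∀ (n k : ℕ) (φ : Fin k → (Fin n → ℝ) → (Fin n → ℝ)), (∀ i, Literature.NumberTheory.Transcendental.IsSemialgebraicMapOn ℚ {x : Fin n → ℝ | ∀ j, 0 < x j ∧ x j < 1} (φ i)) → ∃ τ : Fin k → Set (Fin n → ℝ), (∀ i, τ i ⊆ {x : Fin n → ℝ | ∀ j, 0 < x j ∧ x j < 1} ∧ Literature.ModelTheory.ExponentialFields.IsSemialgebraic ℚ (τ i) ∧ Literature.ModelTheory.ExponentialFields.IsSemialgebraic ℚ (φ i '' τ i)) ∧ (∀ i j, i ≠ j → MeasureTheory.volume (φ i '' τ i ∩ φ j '' τ j) = 0) ∧ (⋃ i, φ i '' τ i) = ⋃ i, φ i '' {x : Fin n → ℝ | ∀ j, 0 < x j ∧ x j < 1}) :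
    ∀ (n : ℕ) (σ : Set (Fin n → ℝ)) (p q : MvPolynomial (Fin n) ℚ), Literature.ModelTheory.ExponentialFields.IsSemialgebraic ℚ σ → Bornology.IsBounded σ → p ≠ 0 → (∀ x ∈ σ, MvPolynomial.aeval x q ≠ 0) → ∃ (k : ℕ) (τ : Fin k → Set (Fin n → ℝ)) (φ : Fin k → (Fin n → ℝ) → (Fin n → ℝ)) (φ' : Fin k → (Fin n → ℝ) → (Fin n → ℝ) →L[ℝ] (Fin n → ℝ)) (u : Fin k → (Fin n → ℝ) → ℝ) (U : Fin k → Set (Fin n → ℝ)) (a : Fin k → Fin n → ℤ), (∀ i, τ i ⊆ {x : Fin n → ℝ | ∀ j, 0 < x j ∧ x j < 1} ∧ Literature.ModelTheory.ExponentialFields.IsSemialgebraic ℚ (τ i) ∧ Literature.NumberTheory.Transcendental.IsSemialgebraicMapOn ℚ {x : Fin n → ℝ | ∀ j, 0 < x j ∧ x j < 1} (φ i) ∧ (∀ x ∈ {x : Fin n → ℝ | ∀ j, 0 < x j ∧ x j < 1}, HasFDerivWithinAt (φ i) (φ' i x) {x : Fin n → ℝ | ∀ j, 0 < x j ∧ x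 j < 1} x) ∧ Set.InjOn (φ i) {x : Fin n → ℝ | ∀ j, 0 < x j ∧ x j < 1} ∧ φ i '' {x : Fin n → ℝ | ∀ j, 0 < x j ∧ x j < 1} ⊆ σ ∧ Literature.ModelTheory.ExponentialFields.IsSemialgebraic ℚ (φ i '' τ i) ∧ IsOpen (U i) ∧ closure {x : Fin n → ℝ | ∀ j, 0 < x j ∧ x j < 1} ⊆ U i ∧ ContDiffOn ℝ 1 (u i) (U i) ∧ (∀ x ∈ U i, u i x ≠ 0) ∧ Literature.NumberTheory.Transcendental.IsSemialgebraicFunOn ℚ {x : Fin n → ℝ | ∀ j, 0 < x j ∧ x j < 1} (u i) ∧ ∀ x ∈ {x : Fin n → ℝ | ∀ j, 0 < x j ∧ x j < 1}, MvPolynomial.aeval (φ i x) p / MvPolynomial.aeval (φ i x) q * |(φ' i x).det| = u i x * ∏ j, x j ^ (a i j)) ∧ (∀ i j, i ≠ j → MeasureTheory.volume (φ i '' τ i ∩ φ j '' τ j) = 0) ∧ MeasureTheory.volume (σ \ ⋃ i, φ i '' τ i) = 0 := by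
  intro n σ p q hσ hb hp hq
  obtain ⟨k, φ, φ', u, U, a, hch, hcov⟩ := h₁ n σ p q hσ hb hp hq
  obtain ⟨τ, hτ, hdisj, hU⟩ := h₂ n k φ fun i => (hch i).1
  refine ⟨k, τ, φ, φ', u, U, a, fun i => ⟨(hτ i).1, (hτ i).2.1, (hch i).1, (hch i).2.1, (hch i).2.2.1,
    (hch i).2.2.2.1, (hτ i).2.2, (hch i).2.2.2.2.1, (hch i).2.2.2.2.2.1, (hch i).2.2.2.2.2.2.1,
    (hch i).2.2.2.2.2.2.2.1, (hch i).2.2.2.2.2.2.2.2.1, (hch i).2.2.2.2.2.2.2.2.2⟩, hdisj, ?_⟩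
  rw [hU]
  exact hcov

/-! ## The composition: the two stubs give the crux BY NAME -/

/-- **`RationalRepsResolve` from the two stub STATEMENTS** (arrow form, conclusion unfolded): stub 1 +
stub 2 give X₁ (`monomialCubeAtlas_of_stubs`), X₂ and X₃ are proved (`cubeMonomialIntegrability`,
`resolvedAtlasRealisation`), and the glue `rationalRepsResolve_of_subs` concludes. [folklore] -/
theorem RationalRepsResolve_of :
    (∀ (n : ℕ) (σ : Set (Fin n → ℝ)) (p q : MvPolynomial (Fin n) ℚ), Literature.ModelTheory.ExponentialFields.IsSemialgebraic ℚ σ → Bornology.IsBounded σ → p ≠ 0 → (∀ x ∈ σ, MvPolynomial.aeval x q ≠ 0) → ∃ (k : ℕ) (φ : Fin k → (Fin n → ℝ) → (Fin n → ℝ)) (φ' : Fin k → (Fin n → ℝ) → (Fin n → ℝ) →L[ℝ] (Fin n → ℝ)) (u : Fin k → (Fin n → ℝ) → ℝ) (U : Fin k → Set (Fin n → ℝ)) (a : Fin k → Fin n → ℤ), (∀ i, Literature.NumberTheory.Transcendental.IsSemialgebraicMapOn ℚ {x : Fin n → ℝ | ∀ j, 0 < x j ∧ x j < 1} (φ i)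 ∧ (∀ x ∈ {x : Fin n → ℝ | ∀ j, 0 < x j ∧ x j < 1}, HasFDerivWithinAt (φ i) (φ' i x) {x : Fin n → ℝ | ∀ j, 0 < x j ∧ x j < 1} x) ∧ Set.InjOn (φ i) {x : Fin n → ℝ | ∀ j, 0 < x j ∧ x j < 1} ∧ φ i '' {x : Fin n → ℝ | ∀ j, 0 < x j ∧ x j < 1} ⊆ σ ∧ IsOpen (U i) ∧ closure {x : Fin n → ℝ | ∀ j, 0 < x j ∧ x j < 1} ⊆ U i ∧ ContDiffOn ℝ 1 (u i) (U i) ∧ (∀ x ∈ U i, u i x ≠ 0) ∧ Literature.NumberTheory.Transcendental.IsSemialgebraicFunOn ℚ {x : Fin n → ℝ | ∀ j, 0 < x j ∧ x j < 1} (u i) ∧ ∀ x ∈ {x : Fin n → ℝ | ∀ j, 0 < x j ∧ x j < 1}, MvPolynomial.aeval (φ i x) p / MvPolynomial.aeval (φ i x) q * |(φ' i x).det| = u i x * ∏ j, x j ^ (a i j)) ∧ MeasureTheory.volume (σ \ ⋃ i, φ i '' {x : Fin n → ℝ | ∀ j, 0 < x j ∧ x j < 1}) = 0) →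
    (∀ (n k : ℕ) (φ : Fin k → (Fin n → ℝ) → (Fin n → ℝ)), (∀ i, Literature.NumberTheory.Transcendental.IsSemialgebraicMapOn ℚ {x : Fin n → ℝ | ∀ j, 0 < x j ∧ x j < 1} (φ i)) → ∃ τ : Fin k → Set (Fin n → ℝ), (∀ i, τ i ⊆ {x : Fin n → ℝ | ∀ j, 0 < x j ∧ x j < 1} ∧ Literature.ModelTheory.ExponentialFields.IsSemialgebraic ℚ (τ i) ∧ Literature.ModelTheory.ExponentialFields.IsSemialgebraic ℚ (φ i '' τ i)) ∧ (∀ i j, i ≠ j → MeasureTheory.volume (φ i '' τ i ∩ φ j '' τ j) = 0) ∧ (⋃ i, φ i '' τ i) = ⋃ i, φ i '' {x : Fin n → ℝ | ∀ j, 0 < x j ∧ x j < 1}) →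
    (∀ (n : ℕ) (r : Literature.NumberTheory.Transcendental.KZ.IntegralRep n), r.IsRational → ∃ (k : ℕ) (ρ : Fin k → Literature.NumberTheory.Transcendental.KZ.IntegralRep n) (ε : Fin k → ℤ), (∀ i, Bornology.IsBounded (ρ i).domain ∧ ∃ U : Set (Fin n → ℝ), IsOpen U ∧ closure (ρ i).domain ⊆ U ∧ ContDiffOn ℝ 1 (ρ i).integrand U) ∧ Literature.NumberTheory.Transcendental.KZ.of r - ∑ i, ε i • Literature.NumberTheory.Transcendental.KZ.of (ρ i) ∈ Literature.NumberTheory.Transcendental.KZ.relations) :=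
  fun h₁ h₂ => rationalRepsResolve_of_subs (monomialCubeAtlas_of_stubs h₁ h₂) cubeMonomialIntegrability
    resolvedAtlasRealisation

/-- **The crux BY NAME, closed modulo the two declared stubs** (sorries live only in `stub_monomialPatches`,
`stub_partitionOfPatches`; everything else in this file is proved). [folklore] -/
theorem RationalRepsResolve_closed :
    Summit.KontsevichZagierPeriods.KontsevichZagierPeriods.Theses.VeryGoodTransfer.RationalRepsResolve :=
  RationalRepsResolve_of stub_monomialPatches stub_partitionOfPatches

end Summit.KontsevichZagierPeriods.KontsevichZagierPeriods.Cruxes.RationalRepsResolve.MonomialCubeAtlas
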